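import Mathlib

/-!
# Constantin–Ignatova–Vicol 2026: the pointwise identities behind the self-similar Kelvin and
# Bernoulli laws for putative Euler collapse, and the arithmetic of their Theorem 3.8

Reproduction (pointwise / arithmetic cores only) from
P. Constantin, M. Ignatova, V. Vicol, *On putative self-similarity for incompressible 3D Euler*,
arXiv:2602.17570 (2026) [ConstantinIgnatovaVicol2026Euler], §3. Chunk locators refer to the arXiv text.
Filed by the solo seat `solo-NavierStokesRegularity-informed` (session 7) as the typed skeleton used
by its note `paper/incoming-stagnation.md`; nothing in this file is new mathematics and nothing here
bears on Navier–Stokes regularity.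

## Setting (informal; only the pointwise algebra is formalised)

A self-similar Euler collapse `u(x,t) = (T-t)^{γ-1} U(x/(T-t)^γ)`, `p = (T-t)^{2γ-2} P`, `0 < γ < 1`,
has profile equations `(1-γ) U + γ (y·∇)U + (U·∇)U + ∇P = 0`, `div U = 0`. With the similarity
velocity `V(y) = γ y + U(y)` (particle paths are `dY/dτ = V(Y)`, `τ = -log(T-t)`), the profile
equation reads `(1-γ) U + (V·∇)U + ∇P = 0`, i.e. POINTWISE at `y`:
`(1-γ) U + A V + q = 0` with `A = ∇U(y)` (Jacobian, `(A V)_i = Σ_j ∂_j U_i V_j`) and `q = ∇P(y)`.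

## What is reproduced

* §3 (chunks p0009–p0010), the Bernoulli-type function `H = ½|V|² + P + γ(γ-1)|y|²/2` and its
  transport law `V·∇H = (2γ-1)|V|²`. Since `∇(½|V|²) = (∇V)ᵀ V = γ V + Aᵀ V`, the law is the
  pointwise identity `V · (γ V + Aᵀ V + q + γ(γ-1) y) = (2γ-1) |V|²`, a consequence of the pointwise
  profile equation alone — `bernoulliTransport_pointwise`. Its sign is what confines backward
  (`γ < 1/2`) resp. forward-bounded (`γ > 1/2`) Lagrangian trajectories: `bernoulliCoeff_eq`,
  `bernoulliCoeff_neg_iff` (the quadratic coefficient of `H` is `γ(2γ-1)/2`).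
* §3, the self-similar Kelvin law `e^{(1-2γ)τ} Γ(τ) = Γ(0)` for the circulation `Γ(τ) = ∮ U·dy` of a
  loop transported by `V`: the exponent is velocity weight `+` length weight, `(γ-1) + γ = 2γ-1`,
  negative iff `γ < 1/2`, zero iff `γ = 1/2` (Leray scaling) — `kelvinExponent_eq`,
  `kelvinExponent_neg_iff`, `kelvinExponent_eq_zero_iff`; and the far-field consistency used in
  §3.3 there: a loop escaping at `|y| ≍ e^{γτ}` where `|U| ≲ |y|^{1-1/γ}` carries circulation of
  weight `γ + γ(1-1/γ) = 2γ-1` — `escapingLoop_exponent`.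
* Theorem 3.8 (chunks p0010–p0011), arithmetic core of the proof: at a node `y*` of `V` with
  `Ω(y*) ≠ 0` the trace-free symmetric matrix `S = sym ∇U(y*)` has `1` as an eigenvalue, the local
  outgoing constant `c*` gives `λ_min(S) ≥ c* - γ`, trace zero then gives `λ_max(S) ≤ 2(γ - c*)`, and
  `1 ∈ [c*-γ, 2(γ-c*)]` forces `γ ≥ c* + 1/2` — `civ38_lambdaMax_le`, `civ38_gamma_ge`.

## Deliberately not here

The analysis (existence/regularity of the Lagrangian flow, Kelvin's theorem itself, compactness of
level sets, Theorems 2.1, 3.10, 4.4, 4.6) is not formalised; the tree has no infrastructure for it at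
this level. The statements above are exactly the finite-dimensional identities one checks by hand
when reading §3.
-/

namespace Literature.Analysis.FluidPDE.ConstantinIgnatovaVicol2026

open Matrix

/-- **Bernoulli transport, pointwise** ([ConstantinIgnatovaVicol2026Euler] §3): if the profile equation
holds at a point in the form `(1-γ) U + A V + q = 0` with `V = γ y + U` (`A = ∇U(y)`, `q = ∇P(y)`),
then `V · ∇H = V · (γ V + Aᵀ V + q + γ(γ-1) y) = (2γ-1) |V|²`.
[cite: ConstantinIgnatovaVicol2026Euler, §3 Bernoulli transport (arXiv chunk p0009–p0010)] -/
theorem bernoulliTransport_pointwise (γ : ℝ) (A : Matrix (Fin 3) (Fin 3) ℝ) (U y q : Fin 3 → ℝ)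
    (hPE : (1 - γ) • U + A *ᵥ (γ • y + U) + q = 0) :
    (γ • y + U) ⬝ᵥ (γ • (γ • y + U) + Aᵀ *ᵥ (γ • y + U) + q + (γ * (γ - 1)) • y)
      = (2 * γ - 1) * ((γ • y + U) ⬝ᵥ (γ • y + U)) := by
  have h0 := congrFun hPE 0
  have h1 := congrFun hPE 1
  have h2 := congrFun hPE 2
  simp only [Pi.add_apply, Pi.smul_apply, smul_eq_mul, Matrix.mulVec, dotProduct,
    Fin.sum_univ_three, Pi.zero_apply] at h0 h1 h2
  simp only [dotProduct, Fin.sum_univ_three, Matrix.mulVec, Matrix.transpose_apply,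
    Pi.add_apply, Pi.smul_apply, smul_eq_mul]
  linear_combination (γ * y 0 + U 0) * h0 + (γ * y 1 + U 1) * h1 + (γ * y 2 + U 2) * h2

/-- The quadratic coefficient of `H = ½|γy+U|² + P + γ(γ-1)|y|²/2` in `|y|²` is `γ(2γ-1)/2`. [folklore] -/
theorem bernoulliCoeff_eq (γ : ℝ) : γ ^ 2 / 2 + γ * (γ - 1) / 2 = γ * (2 * γ - 1) / 2 := by ring

/-- … and it is negative exactly for `0 < γ < 1/2` (given `γ > 0`): then `H → -∞` at infinity as soon
as `|U(y)| = o(|y|)` and `P` is bounded above, so superlevel sets of `H` are compact. [folklore] -/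
theorem bernoulliCoeff_neg_iff {γ : ℝ} (hγ : 0 < γ) : γ * (2 * γ - 1) / 2 < 0 ↔ γ < 1 / 2 := by
  constructor
  · intro h
    by_contra h'
    have h'' : 1 / 2 ≤ γ := not_lt.mp h'
    have : 0 ≤ γ * (2 * γ - 1) := mul_nonneg hγ.le (by linarith)
    linarith
  · intro h
    have : γ * (2 * γ - 1) < 0 := mul_neg_of_pos_of_neg hγ (by linarith)
    linarith

/-- **Self-similar Kelvin exponent**: `∮ u·dx = (T-t)^{(γ-1)+γ} ∮ U·dy` and `(γ-1)+γ = 2γ-1`.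
[cite: ConstantinIgnatovaVicol2026Euler, §3 self-similar Kelvin law (arXiv chunk p0009)] -/
theorem kelvinExponent_eq (γ : ℝ) : (γ - 1) + γ = 2 * γ - 1 := by ring

/-- The circulation of self-similar loops grows backward in `τ` (decays forward) iff `γ < 1/2`. [folklore] -/
theorem kelvinExponent_neg_iff (γ : ℝ) : 2 * γ - 1 < 0 ↔ γ < 1 / 2 := by
  constructor <;> intro h <;> linarith

/-- … and is conserved with no weight iff `γ = 1/2` (Leray / Navier–Stokes scaling). [folklore] -/
theorem kelvinExponent_eq_zero_iff (γ : ℝ) : 2 * γ - 1 = 0 ↔ γ = 1 / 2 := by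
  constructor <;> intro h <;> linarith

/-- Far-field consistency: a loop escaping at `|y| ≍ e^{γτ}` in the region `|U| ≲ |y|^{1-1/γ}`
carries circulation of weight `γ + γ(1 - 1/γ) = 2γ - 1`, exactly the Kelvin weight. [folklore] -/
theorem escapingLoop_exponent {γ : ℝ} (hγ : γ ≠ 0) : γ + γ * (1 - 1 / γ) = 2 * γ - 1 := by
  field_simp
  ring

/-- [ConstantinIgnatovaVicol2026Euler] Thm 3.8, trace step: for the ordered eigenvalues `l₁ ≤ l₂ ≤ l₃` of the
trace-free matrix `S = sym ∇U(y*)`, `λ_min ≥ c* - γ` forces `λ_max ≤ 2(γ - c*)`.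
[cite: ConstantinIgnatovaVicol2026Euler, Thm 3.8 proof (arXiv chunk p0011)] -/
theorem civ38_lambdaMax_le {γ c l₁ l₂ l₃ : ℝ} (htr : l₁ + l₂ + l₃ = 0) (h₁ : c - γ ≤ l₁)
    (h₁₂ : l₁ ≤ l₂) : l₃ ≤ 2 * (γ - c) := by linarith

/-- [ConstantinIgnatovaVicol2026Euler] Thm 3.8, last step: the eigenvalue `1` of `S` (from `Ω(y*) ≠ 0` and
the vorticity equation at the node) lies in `[c* - γ, 2(γ - c*)]`, hence `γ ≥ c* + 1/2`.
[cite: ConstantinIgnatovaVicol2026Euler, Thm 3.8 (arXiv chunks p0010–p0011)] -/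
theorem civ38_gamma_ge {γ c l : ℝ} (hl : l = 1) (hlo : c - γ ≤ l) (hhi : l ≤ 2 * (γ - c)) :
    c + 1 / 2 ≤ γ := by subst hl; linarith

end Literature.Analysis.FluidPDE.ConstantinIgnatovaVicol2026
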